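import Summits.BirchSwinnertonDyer.BirchSwinnertonDyer.Theorems.MordellShaFreeCutCensusPTFree

set_option linter.dupNamespace false
set_option autoImplicit false

/-! # Route `MordellShaFreeCut` (rung S2b) — the BDP road with the two BDP statements (LB-exist) and
(LB-bdp) FOLDED INTO ONE ∃∧ statement «ONE frame with interpolation AND its value at 𝟙»: the
rank-currency plumbing re-proved and the census of crux B in that currency

Cell `bsd-cn100`, prover seat `bsd-cn100-s2b-c3` (g7). Supports, does not close,
stmt-BirchSwinnertonDyer-19160 (crux B `AnalyticRankOneOfRankOneFiniteShaThree`); serves the registered BDP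
line of record `heegner-field-bdp-triple` v6bp on stmt-BirchSwinnertonDyer-19159 (stubs
`stub_threeAdicBDPElementExists` / `stub_threeAdicWanDivisibility` / `stub_threeAdicBDPValueAtOne`).

WHY. The registered (LB-bdp) `ThreeAdicBDPValueAtOne` is an ∀-FRAME statement: the value formula at the
trivial character for EVERY admissible `(ι', Ω_K, Ω_p, 𝓛)` of the frame `IsBDPLFunction ι' v κ γ f Ω_K Ω_p 𝓛`.
What a construction delivers (Castella 2018 Thm. 3.1 + Thm. 3.2 at `p ∤ N`; Bertolini–Darmon–Prasanna 2013
Thm. 5.13; at the additive prime the cell's written transplant, MEMO-transfer-13 §§3–5) is ONE frame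
together with ITS value at `𝟙`. This file records, in the kernel, that the BDP road NEVER needed more:
both plumbing theorems of the road (rank currency, p439508; corank currency, p440480) use (LB-bdp) only
at the frame produced by (LB-exist). So:

* §1 `ThreeAdicBDPElementExistsWithValue` — (LB-exist∧bdp)∃: for the data of the registered stubs, SOME
  embedding datum `ι'` inducing `v` and ONE admissible `(Ω_K, Ω_p, 𝓛)` WITH
  `𝓛(𝟙) = u · c⁻² · (1 − a₃3⁻¹ + [3 ∤ N]3⁻¹)² · (log_ω P)²`, `u ∈ R₀ˣ` (`@[conjecture] def`, OPEN at the
  additive prime `3`, nothing asserted); `bdpExistsWithValue_of_exists_of_value` — it is implied by the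
  registered pair (LB-exist) ∧ (LB-bdp) (trivial calibration);
* §2 the rank-currency plumbing RE-PROVED from (LB-exist∧bdp)∃ + (LB-wan) (p439508's proof with one
  `obtain` instead of two): `heegnerNonTorsion_of_linkA_of_bdpExistsValue` (conclusion = the registered
  `stub_heegnerNonTorsion_of_linkA_of_bdpTriple`'s, token for token);
* §3 the census with every textbook input discharged (Link A `threeAdicControlOfRankOne_holds`, hence
  Poitou–Tate at imaginary quadratic fields): `cruxB_of_bdpExistsValue` — **crux B ⟸ (LB-exist∧bdp)∃ +
  (LB-wan) + six refereed facts, NOTHING ELSE**.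

Siblings: `MordellShaFreeCutThreeAdicBDPExistsValueResidual.lean` (the corank-currency plumbing, crux A and
the leaf in the same currency) and `MordellShaFreeCutThreeAdicBDPValueRigidity.lean` (the converse
bookkeeping: the ∀-frame (LB-bdp) costs, beyond the ∃∧ statement at every `ι'`, exactly an anticyclotomic
CHARACTER SUPPLY — the tree's value-at-𝟙 rigidity theorem
`Summit.BirchSwinnertonDyer.Rank1Residual.X11b.constantCoeff_eq_of_isBDPLFunction_of_supply`).

HONEST FRAMING: CONDITIONAL reductions and one NAMED open statement (weaker than the registered pair);
nothing here proves (LB-exist), (LB-wan), (LB-bdp), crux B, the leaf `rankOne_threeConverse_mordellCurve`,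
Sylvester's conjecture or any case of BSD. PARTITION: none — RANK axis.

[cite: Castella2018, Thm. 3.1 and Thm. 3.2 (shape; nothing asserted at 3 ∣ N)]
[cite: BertoliniDarmonPrasanna2013, Thm. 5.13 (shape of the value at the trivial character)]
[cite: CastellaGrossiLeeSkinner2022, §5.2 (proof of Thm. 5.2.1), Thm. 5.1.3]
[cite: GrossZagier1986, Thm. I.6.3 with V.§2] -/

noncomputable section

open scoped Classical

namespace Summit.BirchSwinnertonDyer.BirchSwinnertonDyer.Theorems.MordellShaFreeCutThreeAdicBDPExistsValue

open PowerSeries WeierstrassCurve NumberField IsDedekindDomain Field Literature.NumberTheory.EllipticCurves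
  Literature.NumberTheory.EllipticCurves.ModularForms Literature.NumberTheory.QuadraticFields
  Literature.NumberTheory.EllipticCurves.Castella2018
open Literature.NumberTheory.GaloisRepresentations Literature.NumberTheory.GaloisCohomology
open Summit.BirchSwinnertonDyer.BirchSwinnertonDyer.Theses.MordellShaFreeCut
open Summit.BirchSwinnertonDyer.BirchSwinnertonDyer.Theorems.MordellShaFreeCutThreeAdicLinks
  (ThreeAdicControlOfRankOne)
open Summit.BirchSwinnertonDyer.BirchSwinnertonDyer.Theorems.MordellShaFreeCutThreeAdicBDPTriple
  (ThreeAdicBDPElementExists ThreeAdicWanDivisibility ThreeAdicBDPValueAtOne)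
open Summit.BirchSwinnertonDyer.BirchSwinnertonDyer.Theorems.MordellShaFreeCutCensusPTFree
  (threeAdicControlOfRankOne_holds)

/-! ## 1. The folded statement (OPEN; named, nothing asserted) and its calibration -/

/-- (LB-exist∧bdp)∃ — **ONE `3`-adic anticyclotomic BDP frame WITH ITS VALUE AT THE TRIVIAL CHARACTER**
for the newform `Dt.f` of the globally minimal `j = 0` curve `W` over an imaginary quadratic Heegner field
`K` with `3 = v v̄` split: for every reading of a Heegner point `P` of level `N = N(W)` through an infinite
place `w` (`w(P) = heegnerPointComplex Dt H`) and every `e : K → ℚ₃` inducing `v`, there are an embedding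
datum `ι' : ℚ̄₃ ≃ ℂ` inducing `v`, CM periods `Ω_K ∈ ℂˣ`, `Ω_p ∈ R₀ˣ` and `𝓛 ∈ R₀⟦T⟧` with Castella's
interpolation property `IsBDPLFunction ι' v κ γ Dt.f Ω_K Ω_p 𝓛` AND
`𝓛(𝟙) = u · c⁻² · (1 − a₃·3⁻¹ + [3 ∤ N]·3⁻¹)² · (log_ω P)²` for some `u ∈ R₀ˣ` (`c = Dt.c` the Manin-type
constant, `a₃ = W.LFunction 3`). The CONJUNCTION of the shapes of Castella 2018 Thm. 3.1 (existence) and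
Thm. 3.2 / BDP 2013 Thm. 5.13 (value at `𝟙`) for ONE frame — exactly what a construction delivers —;
weaker than the registered pair (LB-exist) `ThreeAdicBDPElementExists` ∧ (LB-bdp, ∀-frame)
`ThreeAdicBDPValueAtOne` (`bdpExistsWithValue_of_exists_of_value`). OPEN at the additive prime `3`
(in print only for `p ∤ N`, `p ≥ 5`, and `p ∥ N`); nothing asserted.
[cite: Castella2018, Thm. 3.1 and Thm. 3.2 (shape; nothing asserted at 3 ∣ N)]
[cite: BertoliniDarmonPrasanna2013, Thm. 5.13 (shape)] [cite: CastellaHsieh2018, Def. 3.5 and Prop. 3.6 (shape)] -/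
@[conjecture] def ThreeAdicBDPElementExistsWithValue : Prop :=
  ∀ (W : WeierstrassCurve ℚ) [W.IsElliptic] [W.IsGloballyMinimal], W.j = 0 →
    ∀ (K : Type) [Field K] [NumberField K] (N : ℕ) [NeZero N]
      (Dt : ModularParametrizationData W N)
      (H : HeegnerDatum N (NumberField.discr K)) (w : InfinitePlace K) (e : K →+* ℚ_[3])
      (v : HeightOneSpectrum (𝓞 K)) (κ : ZpExtension K 3) (γ : absoluteGaloisGroup K)
      [Fact (κ.IsTopGenerator γ)] (P : (W.baseChange K).toAffine.Point),
    W.conductorNorm ℤ = N → IsImaginaryQuadratic K →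
    SatisfiesHeegnerHypothesis N K → ((Ideal.span {(3 : ℤ)}).primesOver (𝓞 K)).ncard = 2 →
    ((3 : ℕ) : 𝓞 K) ∈ v.asIdeal → κ.IsAnticyclotomic →
    WeierstrassCurve.Affine.Point.map w.embedding.toRatAlgHom P = heegnerPointComplex Dt H →
    (∀ k : 𝓞 K, k ∈ v.asIdeal ↔ ‖e (k : K)‖ < 1) →
    ∃ ι' : PadicAlgCl 3 ≃+* ℂ,
      (∀ (w' : InfinitePlace K) (k : 𝓞 K), k ∈ v.asIdeal ↔ ‖ι'.symm (w'.embedding (k : K))‖ < 1) ∧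
      ∃ (ΩK : ℂ) (Ωp : (unrIntegers 3)ˣ) (L : UnrSeries 3),
        ΩK ≠ 0 ∧ IsBDPLFunction ι' v κ γ Dt.f ΩK ((Ωp : unrIntegers 3) : ℂ_[3]) L ∧
        ∃ u : (unrIntegers 3)ˣ, L.HasValueAt 0
          (((u : unrIntegers 3) : ℂ_[3]) *
            algebraMap ℚ_[3] ℂ_[3] (((Dt.c : ℚ_[3])⁻¹) ^ 2 *
              (1 - (W.LFunction 3 : ℚ_[3]) * (3 : ℚ_[3])⁻¹ +
                (if (3 : ℕ) ∣ N then 0 else (3 : ℚ_[3])⁻¹)) ^ 2 *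
              (padicLogOmega W 3 e P) ^ 2))

/-- **Calibration: the registered pair (LB-exist) ∧ (LB-bdp, ∀-frame) implies (LB-exist∧bdp)∃** — take
(LB-exist)'s frame and apply (LB-bdp) to it. So the folded statement is AT MOST as strong as the two
registered stubs it replaces in the plumbing. [folklore] -/
theorem bdpExistsWithValue_of_exists_of_value (hE : ThreeAdicBDPElementExists)
    (hV : ThreeAdicBDPValueAtOne) : ThreeAdicBDPElementExistsWithValue := by
  intro W _ _ hj K _ _ N _ Dt H w e v κ γ _ P hN hK hHN hsplit hv3 hκ hP he
  obtain ⟨ι', hι', ΩK, Ωp, L, hΩK, hBDP⟩ := hE W hj K N Dt v κ γ hN hK hHN hsplit hv3 hκ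
  obtain ⟨u, hu⟩ :=
    hV W hj ι' K N Dt H w e v κ γ P hN hK hHN hsplit hv3 hι' hκ hP he ΩK Ωp L hΩK hBDP
  exact ⟨ι', hι', ΩK, Ωp, L, hΩK, hBDP, u, hu⟩

/-! ## 2. The rank-currency plumbing of the BDP road from (LB-exist∧bdp)∃ + (LB-wan) -/

/-- **Rank-currency plumbing from the folded statement** (conclusion = the registered
`stub_heegnerNonTorsion_of_linkA_of_bdpTriple`'s, token for token; proof = p439508's with ONE `obtain` from
(LB-exist∧bdp)∃ at the Galois-conjugate reading `P' = τ_* P` in place of the two from (LB-exist), (LB-bdp)):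
Kato descends the rank-one data to `K`; Link A (`hA`) gives a generator `F` of `char_Λ 𝔛` with `F(0) ≠ 0`;
(LB-exist∧bdp)∃ supplies `(ι', Ω_K, Ω_p, 𝓛)` WITH `𝓛(𝟙) = u·c⁻²·(…)²·(log_ω P')²`; (LB-wan) along
`toUnr : ℤ₃ → R₀` forces `𝓛(𝟙) ≠ 0`; a torsion `P` would give `log_ω P' = 0`. CONDITIONAL on the named
inputs; credits nothing. [cite: CastellaGrossiLeeSkinner2022, §5.2 (proof of Thm. 5.2.1)]
[cite: Castella2018, proof of Thm. 2.3 with Thm. 3.4 (shape)] [cite: SilvermanAEC2009, IV.6.4 and VII.2.2] -/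
theorem heegnerNonTorsion_of_linkA_of_bdpExistsValue
    (hKato : ∀ (W : WeierstrassCurve ℚ) [W.IsElliptic] (p : ℕ) [Fact p.Prime],
      kato_finite_of_L_one_ne_zero W p)
    (hA : ThreeAdicControlOfRankOne) (hEV : ThreeAdicBDPElementExistsWithValue)
    (hWan : ThreeAdicWanDivisibility) :
    ∀ (W : WeierstrassCurve ℚ) [W.IsElliptic] [W.IsGloballyMinimal], W.j = 0 →
      ∀ (K : Type) [Field K] [NumberField K] (N : ℕ) [NeZero N], W.conductorNorm ℤ = N →
        IsImaginaryQuadratic K → SatisfiesHeegnerHypothesis N K → SatisfiesHeegnerHypothesis 3 K →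
          (W.quadraticTwist (NumberField.discr K : ℚ)).entireLFunction 1 ≠ 0 →
            W.mordellWeilRank = 1 → Finite (AddCommGroup.primaryComponent W.sha 3) →
              ∀ (P : (W.baseChange K).toAffine.Point), IsHeegnerPoint N W K P →
                ¬ IsOfFinAddOrder P := by
  intro W _ _ hj K _ _ N _ hN hK hHN hH3 hL hrank hsha P hP
  -- (0) `3 = v v̄` splits in `K`
  have hsplit : ((Ideal.span {(3 : ℤ)}).primesOver (𝓞 K)).ncard = 2 := by
    simpa using hH3 3 Nat.prime_three (dvd_refl 3)
  -- (1) the rank-one data over `K` (Kato on the twist)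
  obtain ⟨hrk, -, hshaK⟩ :=
    AcPConverseLinks.rank_corank_sha_baseChange_of_twist_L_one_ne_zero hKato W 3 hK hL hrank hsha
  -- (2) the anticyclotomic datum `(κ, γ)`, THE embedding at a degree-one `𝔭 ∋ 3`, `v`, `v̄`
  obtain ⟨κ, γ, 𝔭, hκ, hγ, h𝔭, he, hf⟩ :=
    Summit.BirchSwinnertonDyer.Rank1Residual.X11b.exists_anticyclotomic_generator_degreeOnePrime
      3 K hK hH3
  haveI : Fact (κ.IsTopGenerator γ) := ⟨hγ⟩
  set ι : K →+* ℚ_[3] := Summit.BirchSwinnertonDyer.Rank1Residual.X11b.embAt K 3 𝔭 h𝔭 he hf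
    with hιdef
  set v := Summit.BirchSwinnertonDyer.Rank1Residual.X11b.inducedPlace ι with hvdef
  have hv : ∀ x : 𝓞 K, x ∈ v.asIdeal ↔ ‖ι (x : K)‖ < 1 :=
    Summit.BirchSwinnertonDyer.Rank1Residual.X11b.mem_inducedPlace_iff ι
  have hv3 : ((3 : ℕ) : 𝓞 K) ∈ v.asIdeal :=
    Summit.BirchSwinnertonDyer.Rank1Residual.X11b.natCast_mem_inducedPlace ι
  obtain ⟨vbar, hvbar, hne⟩ :=
    Summit.BirchSwinnertonDyer.Rank1Residual.X11b.exists_other_prime hH3 v hv3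
  -- (3) Link A at this datum: a generator `F` of `char_Λ 𝔛` with `F(0) ≠ 0`
  obtain ⟨m, -, F, hF, hF0, -⟩ := hA W hj K N hN hK hHN hH3 ι v vbar hv hvbar hne κ hκ γ hrk hshaK
  -- (4) the Heegner datum of `P`; the Galois conjugate `P'` read through THE infinite place `w₀`
  obtain ⟨Dt, H, ιK, hPι⟩ := hP
  obtain ⟨w₀⟩ := (inferInstance : Nonempty (InfinitePlace K))
  haveI : IsGalois ℚ K := by
    haveI : Algebra.IsQuadraticExtension ℚ K := ⟨hK.1⟩
    infer_instance
  obtain ⟨σ, hσ⟩ := ComplexEmbedding.exists_comp_symm_eq_of_comp_eq (k := ℚ) w₀.embedding ιK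
    (by ext x; simp)
  set τ : K →+* K := ((σ.symm : K ≃ₐ[ℚ] K) : K →+* K) with hτdef
  set P' := WeierstrassCurve.Affine.Point.map τ.toRatAlgHom P with hP'def
  have hP' : WeierstrassCurve.Affine.Point.map w₀.embedding.toRatAlgHom P' =
      heegnerPointComplex Dt H := by
    rw [hP'def, WeierstrassCurve.Affine.Point.map_map]
    have hcomp : w₀.embedding.toRatAlgHom.comp τ.toRatAlgHom = ιK.toRatAlgHom := by
      apply AlgHom.ext
      intro x
      have := RingHom.congr_fun hσ x
      simpa [hτdef] using this
    rw [hcomp]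
    exact hPι
  -- (5) (LB-exist∧bdp)∃ at `(Dt, H, w₀, ι, v, κ, γ, P')`: ONE frame WITH its value at `𝟙`
  obtain ⟨ι', hι', ΩK, Ωp, L, hΩK, hBDP, u, hu⟩ :=
    hEV W hj K N Dt H w₀ ι v κ γ P' hN hK hHN hsplit hv3 hκ hP' hv
  -- (6) (LB-wan) along the structure map `toUnr : ℤ₃ → R₀` forces `𝓛(0) ≠ 0`
  obtain ⟨k, hk⟩ := hWan W hj ι' K N Dt v vbar κ γ hN hK hHN hsplit hι' hvbar hne hκ ΩK Ωp L hΩK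
    hBDP (Summit.BirchSwinnertonDyer.Rank1Residual.X11b.Halves.toUnr 3)
    (Summit.BirchSwinnertonDyer.Rank1Residual.X11b.Halves.coe_toUnr 3)
  have hFmem : F ∈ AcSelmer.XAc.charIdeal (W.baseChange K) 3 κ vbar ∅ γ := by
    rw [hF]; exact Ideal.mem_span_singleton_self F
  obtain ⟨G, hG⟩ := Ideal.mem_span_singleton'.mp (hk F hFmem)
  have hL0 : PowerSeries.constantCoeff L ≠ 0 := by
    intro h0
    have h1 := congrArg (fun S : UnrSeries 3 ↦ ((PowerSeries.constantCoeff S : unrIntegers 3) : ℂ_[3])) hG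
    simp only [map_mul, h0, mul_zero, PowerSeries.constantCoeff_C,
      Summit.BirchSwinnertonDyer.Rank1Residual.X11b.CongruenceLimit.constantCoeff_map_apply, Subring.coe_mul,
      Subring.coe_pow, Subring.coe_zero,
      Summit.BirchSwinnertonDyer.Rank1Residual.X11b.Halves.coe_toUnr] at h1
    have h3' : ((3 : unrIntegers 3) : ℂ_[3]) = (3 : ℂ_[3]) := by norm_cast
    rw [h3'] at h1
    have h3 : algebraMap ℚ_[3] ℂ_[3] ((PowerSeries.constantCoeff F : ℤ_[3]) : ℚ_[3]) = 0 := by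
      rcases mul_eq_zero.mp h1.symm with h | h
      · exact absurd (pow_eq_zero_iff'.mp h).1 three_ne_zero
      · exact h
    rw [map_eq_zero_iff _ (algebraMap ℚ_[3] ℂ_[3]).injective] at h3
    exact hF0 (PadicInt.coe_eq_zero.mp h3)
  -- (7) the value at `𝟙` is `u · c⁻² · (…)² · (log_ω P')²`
  have hval := UnrSeries.eq_constantCoeff_of_hasValueAt_zero hu
  -- (8) a torsion `P` makes `P'` torsion and `log_ω P' = 0`, contradicting `𝓛(0) ≠ 0`
  intro hPtor
  have hP'tor : IsOfFinAddOrder P' := by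
    rw [hP'def]
    exact AddMonoidHom.isOfFinAddOrder _ hPtor
  have hlog : padicLogOmega W 3 ι P' = 0 := by
    unfold padicLogOmega
    rw [AcPConverseLinks.padicLogPoint_formalIndex_smul_eq_zero_of_isOfFinAddOrder W 3 ι hP'tor,
      zero_div]
  apply hL0
  rw [hlog, zero_pow two_ne_zero, mul_zero, map_zero, mul_zero] at hval
  exact_mod_cast hval.symm

/-! ## 3. The census of crux B in the folded currency (every textbook input discharged) -/

/-- **Heegner non-torsion at `3` ⟸ Kato + (LB-exist∧bdp)∃ + (LB-wan)** — the rank-currency plumbing with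
Link A DISCHARGED (`MordellShaFreeCutCensusPTFree.threeAdicControlOfRankOne_holds`, p457647). CONDITIONAL
on Kato's theorem (refereed) and the two research statements; credits nothing beyond the reduction.
[cite: CastellaGrossiLeeSkinner2022, §5.2 (proof of Thm. 5.2.1)] [cite: Kato2004, Cor. 14.3] -/
theorem heegnerNonTorsionAtThree_of_bdpExistsValue
    (hKato : ∀ (W : WeierstrassCurve ℚ) [W.IsElliptic] (p : ℕ) [Fact p.Prime],
      kato_finite_of_L_one_ne_zero W p)
    (hEV : ThreeAdicBDPElementExistsWithValue) (hWan : ThreeAdicWanDivisibility) :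
    ∀ (W : WeierstrassCurve ℚ) [W.IsElliptic] [W.IsGloballyMinimal], W.j = 0 →
      ∀ (K : Type) [Field K] [NumberField K] (N : ℕ) [NeZero N], W.conductorNorm ℤ = N →
        IsImaginaryQuadratic K → SatisfiesHeegnerHypothesis N K → SatisfiesHeegnerHypothesis 3 K →
          (W.quadraticTwist (NumberField.discr K : ℚ)).entireLFunction 1 ≠ 0 →
            W.mordellWeilRank = 1 → Finite (AddCommGroup.primaryComponent W.sha 3) →
              ∀ (P : (W.baseChange K).toAffine.Point), IsHeegnerPoint N W K P →
                ¬ IsOfFinAddOrder P :=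
  heegnerNonTorsion_of_linkA_of_bdpExistsValue hKato threeAdicControlOfRankOne_holds hEV hWan

/-- **KERNEL CENSUS OF CRUX B in the folded currency: `AnalyticRankOneOfRankOneFiniteShaThree` ⟸
(LB-exist∧bdp)∃ + (LB-wan) + six refereed facts** (`3`-parity, modularity, Hoffstein–Luo, Kato, existence
of Heegner points, Gross–Zagier + Kolyvagin) — NOTHING ELSE: the v2 composition
`MordellShaFreeCutOfHeegnerNonTorsion.analyticRankOne_of_facts_of_heegnerNonTorsion` (p419697) fed with
`heegnerNonTorsionAtThree_of_bdpExistsValue`. Compared with the registered census `cruxB_of_bdpTriple`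
(p457647): the ∀-frame (LB-bdp) and (LB-exist) are replaced by the single weaker ∃∧ statement; the
research content of crux B on the BDP road is ONE construction-with-value + ONE main-conjecture
divisibility at the additive prime `3`. CONDITIONAL; credits nothing; BSD untouched.
[cite: CastellaGrossiLeeSkinner2022, §5.2 (proof of Thm. 5.2.1)] [cite: GrossZagier1986, Thm. I.6.3 with V.§2]
[cite: Kato2004, Cor. 14.3] [cite: DokchitserDokchitserAnnals2010, Thm. 1.4] -/
theorem cruxB_of_bdpExistsValue
    (hpar : ∀ (W : WeierstrassCurve ℚ) [W.IsElliptic] (p : ℕ) [Fact p.Prime], p_parity W p)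
    (hmod : ModularForms.exists_isNewformOf) (hHL : HoffsteinLuo1997_exists_twist_L_one_ne_zero)
    (hKato : ∀ (W : WeierstrassCurve ℚ) [W.IsElliptic] (p : ℕ) [Fact p.Prime],
      kato_finite_of_L_one_ne_zero W p)
    (hHP : ∀ (W : WeierstrassCurve ℚ) (K : Type) [Field K] [NumberField K],
      exists_isHeegnerPoint W K)
    (hGZ : ∀ (W : WeierstrassCurve ℚ) (N : ℕ) [NeZero N] (K : Type) [Field K] [NumberField K],
      analyticRankEK_eq_one_iff_heegner_nonTorsion W N K)
    (hEV : ThreeAdicBDPElementExistsWithValue) (hWan : ThreeAdicWanDivisibility) :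
    AnalyticRankOneOfRankOneFiniteShaThree :=
  MordellShaFreeCutOfHeegnerNonTorsion.analyticRankOne_of_facts_of_heegnerNonTorsion
    hpar hmod hHL hKato hHP hGZ (heegnerNonTorsionAtThree_of_bdpExistsValue hKato hEV hWan)

end Summit.BirchSwinnertonDyer.BirchSwinnertonDyer.Theorems.MordellShaFreeCutThreeAdicBDPExistsValue

end
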